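import Summits.SmoothPoincare4.SmoothPoincare4.Theorems.ConvexBisectionAcyclicBisectionExistsKasBaseBoundary
import Summits.SmoothPoincare4.SmoothPoincare4.Theorems.ConvexBisectionAcyclicBisectionExistsMultiAttachmentH1
import Literature.Topology.FourManifolds.LefschetzHandlebody
import Literature.Topology.FourManifolds.LefschetzBaseBetti
import Literature.Topology.FourManifolds.BoundaryGluingRelHomology
import Literature.GroupTheory.CombinatorialGroupTheory.SignedHurwitzAction
import Literature.GroupTheory.CombinatorialGroupTheory.SignedHurwitzStabilisation
import Literature.AlgebraicTopology.SingularHomology.ExcisionMayerVietorisProofs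
import HarnessLib

/-!
# Stub `stub_genusOneDet` (D-det) of line `folded-curve-branch-locus` for crux
# `ConvexBisection.AcyclicBisectionRigidity` (stmt-SmoothPoincare4-10507): a homotopy 4-sphere in
# Matsumoto normal form has `|u × w| = 1`

Registered signature (lead a4, reshape s3, 2026-08-17): for a Hausdorff second-countable `C^∞`
4-manifold `M ≃ₕ S⁴` with the fibred Lefschetz model of the genus-`1` normal-form word
`l = [(u,η),(u,¬η),(w,η′),(w,¬η′)]` (`ModelsOnFibred M 1 l`: `M = X ∪_Ψ Base 1`, `X = X(F_{1,1}; l)`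
the Lefschetz handlebody of `l` over the concrete base `Base 1`), `stdSymp ℤ 1 u w = ±1`.

Proof (Gompf–Stipsicz 1999, §8.2, integrally):

1. `M = X ∪_Ψ Base 1` (`ModelsOnFibred.modelsOn`, unfolded).
2. **`H₁(X; ℤ) = 0`**: `H₂(Base 1; ℤ) = 0` and `H₁(Base 1; ℤ)` free (`LefschetzBaseBetti.lean`,
   Milnor 1968 Thm. 9.1) give `H²(Base 1; ℤ) = 0` (universal coefficients,
   `subsingleton_cohomology_of_isZero`); the base is orientable (`isOrientable_base`), so integral
   Lefschetz duality gives `H₂(Base 1, ∂; ℤ) = 0` (`isZero_relHomology_int_of_subsingleton_cohomology`);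
   excision for the gluing (`BoundaryGluingData.isIso_map_jB_boundary'`, integral form of
   `isZero_relHomology_range_of_isZero`) gives `H₂(M, jA X; ℤ) = 0`; `H₁(M; ℤ) = H₁(S⁴; ℤ) = 0`; and
   exactness of `H₂(M, jA X) → H₁(jA X) → H₁(M)` finishes.
3. **`ℤ u + ℤ w = ℤ²`**: `H₁(X; ℤ) ≅ ℤ² ⧸ span ℤ (letters l)` (PROVED tree fact NF5,
   `stub_isLefschetzHandlebody_homology_H1`) and `letters l ⊆ {u, w}`.
4. **Algebra**: writing `e₁ = a u + b w`, `e₂ = c u + d w` gives `(ad − bc)(u × w) = 1` in `ℤ`, so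
   `u × w = stdSymp ℤ 1 u w = u₀ w₁ − u₁ w₀ = ±1`.

Everything is proved from tree theorems; no named facts are introduced, no `sorry`.
-/

noncomputable section

-- the prescribed namespace `Summit.<P>.<Sub>.…` duplicates `SmoothPoincare4` (P = Sub)
set_option linter.dupNamespace false

open scoped Manifold ContDiff Topology ContinuousMap
open Set Function
open CategoryTheory CategoryTheory.Limits
open Literature.AlgebraicTopology.SingularHomology
open Literature.Topology.FourManifolds Literature.Topology.FourManifolds.LefschetzBase
open Literature.GroupTheory.CombinatorialGroupTheory.SignedHurwitz

namespace Summit.SmoothPoincare4.SmoothPoincare4.Theorems.AcyclicBisectionRigidity.FoldedCurveBranchLocus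

open Summit.SmoothPoincare4.SmoothPoincare4.Theorems.AcyclicBisectionExists.ModpBraidOrbits

/-- Local notation: `𝔼 n = ℝⁿ` (model space), as in the skeleton of the line. -/
local notation "𝔼 " n:arg => EuclideanSpace ℝ (Fin n)

/-- Local notation: the round 4-sphere `S⁴ ⊂ ℝ⁵`, as in the skeleton of the line. -/
local notation "𝕊⁴" => (Metric.sphere (0 : EuclideanSpace ℝ (Fin 5)) 1)

/-! ### Excision for a boundary gluing, integral coefficients -/

section Excision

variable {M : Type} [TopologicalSpace M] [T2Space M] [SecondCountableTopology M]
  [ChartedSpace (EuclideanSpace ℝ (Fin 4)) M] [IsManifold (𝓡 4) ∞ M]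
  {A : Type} [TopologicalSpace A] [T2Space A] [SecondCountableTopology A] [CompactSpace A]
  [ChartedSpace (EuclideanHalfSpace 4) A] [IsManifold (𝓡∂ 4) ∞ A]
  {B : Type} [TopologicalSpace B] [T2Space B] [SecondCountableTopology B] [CompactSpace B]
  [ChartedSpace (EuclideanHalfSpace 4) B] [IsManifold (𝓡∂ 4) ∞ B]

omit [T2Space M] [SecondCountableTopology M] in
/-- **Excision for a boundary gluing, abstract boundary data, integral coefficients**: if
`M = A ∪_φ B` with witnessing embeddings `jA`, `jB` and `∂B ≠ ∅`, then
`Hₖ(B, ∂B; ℤ) = 0 ⇒ Hₖ(M, jA A; ℤ) = 0` — the tree's `BoundaryGluingData.isIso_map_jB_boundary'`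
(`(jB)_* : Hₖ(B, ∂B) ≅ Hₖ(M, jA A)`, Hatcher Thm 2.20 / Prop 2.22, all coefficients) read on the
null-cobordisms `A`, `B` of the abstract boundaries. [folklore] -/
theorem isZero_relHomology_range_int_of_isZero (bA : BoundaryData (𝓡∂ 4) A (𝓡 3))
    (bB : BoundaryData (𝓡∂ 4) B (𝓡 3)) [Nonempty bB.carrier] (φ : bA.carrier ≃ₘ⟮𝓡 3, 𝓡 3⟯ bB.carrier)
    {jA : A → M} {jB : B → M} (hjA : Manifold.IsSmoothEmbedding (𝓡∂ 4) (𝓡 4) ∞ jA)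
    (hjB : Manifold.IsSmoothEmbedding (𝓡∂ 4) (𝓡 4) ∞ jB) (hcover : range jA ∪ range jB = univ)
    (hR : ∀ a b, jA a = jB b ↔ ∃ z, a = bA.incl z ∧ b = bB.incl (φ z)) {k : ℕ}
    (hk : IsZero (relativeSingularHomology ℤ ℤ B ((𝓡∂ 4).boundary B) k)) :
    IsZero (relativeSingularHomology ℤ ℤ M (range jA) k) := by
  -- adapted from `isZero_relHomology_range_of_isZero`
  -- (Summits/SmoothPoincare4/SmoothPoincare4/Theorems/ConvexBisectionAcyclicBisectionExistsStubNiceSplitting.lean)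
  -- bridging instances at `2 + 1 + 1` / `2 + 1`
  letI iA1 : ChartedSpace (EuclideanHalfSpace (2 + 1 + 1)) A := ‹ChartedSpace (EuclideanHalfSpace 4) A›
  letI iA2 : IsManifold (𝓡∂ (2 + 1 + 1)) ∞ A := ‹IsManifold (𝓡∂ 4) ∞ A›
  letI iB1 : ChartedSpace (EuclideanHalfSpace (2 + 1 + 1)) B := ‹ChartedSpace (EuclideanHalfSpace 4) B›
  letI iB2 : IsManifold (𝓡∂ (2 + 1 + 1)) ∞ B := ‹IsManifold (𝓡∂ 4) ∞ B›
  letI iM1 : ChartedSpace (EuclideanSpace ℝ (Fin (2 + 1 + 1))) M := ‹ChartedSpace (EuclideanSpace ℝ (Fin 4)) M›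
  letI iM2 : IsManifold (𝓡 (2 + 1 + 1)) ∞ M := ‹IsManifold (𝓡 4) ∞ M›
  letI ia3 : ChartedSpace (EuclideanSpace ℝ (Fin (2 + 1))) bA.carrier := bA.chartedSpace
  letI ia4 : IsManifold (𝓡 (2 + 1)) ∞ bA.carrier := bA.isManifold
  letI ib3 : ChartedSpace (EuclideanSpace ℝ (Fin (2 + 1))) bB.carrier := bB.chartedSpace
  letI ib4 : IsManifold (𝓡 (2 + 1)) ∞ bB.carrier := bB.isManifold
  haveI : CompactSpace bB.carrier := bB.compactSpace_carrier
  haveI : T2Space bB.carrier := bB.isSmoothEmbedding.isEmbedding.t2Space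
  -- the pieces as null-cobordisms of their abstract boundaries, and the gluing data over them
  let cA : NullCobordism (2 + 1) bA.carrier :=
    { W := A
      incl := bA.incl
      isSmoothEmbedding_incl := bA.isSmoothEmbedding
      range_incl := bA.range_incl }
  let cB : NullCobordism (2 + 1) bB.carrier :=
    { W := B
      incl := bB.incl
      isSmoothEmbedding_incl := bB.isSmoothEmbedding
      range_incl := bB.range_incl }
  let G : BoundaryGluingData cA.boundaryData cB.boundaryData φ.toEquiv M :=
    { jA := jA
      jB := jB
      isSmoothEmbedding_jA := hjA
      isSmoothEmbedding_jB := hjB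
      range_union := hcover
      jA_eq_jB_iff := hR }
  haveI := G.isIso_map_jB_boundary' ℤ ℤ k
  exact hk.of_iso (asIso (relativeSingularHomology.map ℤ ℤ
    (⟨G.jB, G.continuous_jB⟩ : C(cB.W, M)) G.mapsTo_jB_boundary k)).symm

end Excision

/-! ### `H₁(X; ℤ) = 0` for the handlebody side of a one-sided gluing over `Base 1` -/

section Gluing

variable {M : Type} [TopologicalSpace M] [ChartedSpace (EuclideanSpace ℝ (Fin 4)) M]
  [IsManifold (𝓡 4) ∞ M]
  {X : Type} [TopologicalSpace X] [T2Space X] [SecondCountableTopology X] [CompactSpace X]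
  [ChartedSpace (EuclideanHalfSpace 4) X] [IsManifold (𝓡∂ 4) ∞ X]

/-- **`H²(Base g; ℤ) = 0`**: `H₂(Base g; ℤ) = 0` and `H₁(Base g; ℤ)` free (Milnor 1968, Thm. 9.1;
tree `isZero_singularHomology_base_of_two_le`, `free_singularHomology_base_one`), so the universal
coefficient theorem (`subsingleton_cohomology_of_isZero`) kills `H²`. [folklore] -/
theorem subsingleton_cohomology_base_two (g : ℕ) : Subsingleton (singularCohomology ℤ ℤ (Base g) 2) := by
  haveI := free_singularHomology_base_one g
  exact subsingleton_cohomology_of_isZero 1 (isZero_singularHomology_base_of_two_le ℤ ℤ g le_rfl)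

/-- **`H₁(X; ℤ) = 0` for the handlebody side of a one-sided gluing `M = X ∪_Ψ Base g` of a homotopy
4-sphere** (integral version of `isZero_homology_one_of_gluing_base`).  In the exact
`H₂(M, jX X) → H₁(jX X) → H₁(M) = 0` the left group is `H₂(Base g, ∂ Base g; ℤ) ≅ H²(Base g; ℤ) = 0`
(excision for the gluing; integral Lefschetz duality for the orientable base; universal
coefficients with `H₂(Base g; ℤ) = 0`, `H₁(Base g; ℤ)` free).  Gompf–Stipsicz 1999, §8.2:
"`H₁(X; ℤ) = H₁(M; ℤ) = 0`, the cap adds only 3- and 4-handles". [folklore] -/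
theorem isZero_homology_one_int_of_gluing_base {g : ℕ}
    (e : M ≃ₕ Metric.sphere (0 : EuclideanSpace ℝ (Fin 5)) 1)
    (bX : BoundaryData (𝓡∂ 4) X (𝓡 3)) (Ψ : bX.carrier ≃ₘ⟮𝓡 3, 𝓡 3⟯ (bBase g).carrier)
    (hglue : IsBoundaryGluing bX (bBase g) Ψ (𝓡 4) M) : IsZero (singularHomology ℤ ℤ X 1) := by
  -- adapted from `isZero_homology_one_of_gluing_base`
  -- (Summits/SmoothPoincare4/SmoothPoincare4/Theorems/ConvexBisectionAcyclicBisectionExistsStubModelsOnCounts.lean)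
  haveI : Nonempty (bBase g).carrier := nonempty_bBase_carrier g
  obtain ⟨jA, jB, hjA, hjB, hcover, hR⟩ := hglue
  -- `H₂(Base g, ∂; ℤ) = 0`; `H₂(M, jA X; ℤ) = 0`
  have hrelB : IsZero (relativeSingularHomology ℤ ℤ (Base g) ((𝓡∂ 4).boundary (Base g)) 2) :=
    isZero_relHomology_int_of_subsingleton_cohomology (bBase g) (isOrientable_base g)
      (p := 2) (q := 2) rfl (subsingleton_cohomology_base_two g)
  have hrelM : IsZero (relativeSingularHomology ℤ ℤ M (range jA) 2) :=
    isZero_relHomology_range_int_of_isZero bX (bBase g) Ψ hjA hjB hcover hR hrelB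
  -- `H₁(M; ℤ) = 0`, and exactness at `H₁(jA X)`
  have hM1 : IsZero (singularHomology ℤ ℤ M 1) :=
    (isZero_singularHomology_sphere_holds ℤ ℤ (n := 4) one_ne_zero (by norm_num)).of_iso
      (singularHomology.isoOfHomotopyEquiv ℤ ℤ e 1)
  have hS : IsZero (singularHomology ℤ ℤ ↥(range jA) 1) :=
    (relativeSingularHomology.exact_δ_map ℤ ℤ (range jA) 1).isZero_of_both_zeros
      (hrelM.eq_of_src _ _) (hM1.eq_of_tgt _ _)
  exact hS.of_iso (singularHomology.mapIso ℤ ℤ hjA.isEmbedding.toHomeomorph 1)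

/-- **The letters of the Lefschetz handlebody of a one-sided model of a homotopy 4-sphere span
`ℤ^{2g}` integrally**: `H₁(X; ℤ) ≅ ℤ^{2g} ⧸ span ℤ (letters l)` (Gompf–Stipsicz §8.2, tree
`stub_isLefschetzHandlebody_homology_H1`) vanishes. [folklore] -/
theorem span_letters_eq_top_of_gluing_base {g : ℕ} {l : List ((Fin g ⊕ Fin g → ℤ) × Bool)}
    (e : M ≃ₕ Metric.sphere (0 : EuclideanSpace ℝ (Fin 5)) 1) (bX : BoundaryData (𝓡∂ 4) X (𝓡 3))
    (Ψ : bX.carrier ≃ₘ⟮𝓡 3, 𝓡 3⟯ (bBase g).carrier) (hglue : IsBoundaryGluing bX (bBase g) Ψ (𝓡 4) M)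
    (hX : IsLefschetzHandlebody g l X) : Submodule.span ℤ (letters l) = ⊤ := by
  obtain ⟨e1⟩ := stub_isLefschetzHandlebody_homology_H1 g l X hX
  haveI : Subsingleton (singularHomology ℤ ℤ X 1) :=
    ModuleCat.subsingleton_of_isZero (isZero_homology_one_int_of_gluing_base e bX Ψ hglue)
  haveI : Subsingleton ((Fin g ⊕ Fin g → ℤ) ⧸ Submodule.span ℤ (letters l)) :=
    e1.symm.toEquiv.subsingleton
  exact Submodule.Quotient.subsingleton_iff.mp ‹_›

end Gluing

/-! ### The algebra of genus one: `ℤ u + ℤ w = ℤ² ⇒ u × w = ±1` -/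

/-- The letters of the normal-form word `[(u,η),(u,¬η),(w,η′),(w,¬η′)]` are among `u`, `w`.
[folklore] -/
theorem letters_normalForm_subset {V : Type*} (u w : V) (η η' : Bool) :
    letters [(u, η), (u, !η), (w, η'), (w, !η')] ⊆ {u, w} := by
  rintro v ⟨s, hs⟩
  simp only [List.mem_cons, Prod.mk.injEq, List.not_mem_nil, or_false] at hs
  rcases hs with ⟨rfl, -⟩ | ⟨rfl, -⟩ | ⟨rfl, -⟩ | ⟨rfl, -⟩ <;> simp

/-- **`ℤ u + ℤ w = ℤ²` forces `u₀ w₁ − u₁ w₀ = ±1`**: writing the two basis vectors as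
`e₁ = a u + b w`, `e₂ = c u + d w` gives the matrix identity `[[a,b],[c,d]] · [[u₀,u₁],[w₀,w₁]] = 1`,
whose determinant is `(ad − bc)(u₀ w₁ − u₁ w₀) = 1` in `ℤ`. [folklore] -/
theorem det_eq_one_or_neg_one_of_span_pair_eq_top (u w : Fin 1 ⊕ Fin 1 → ℤ)
    (h : Submodule.span ℤ ({u, w} : Set (Fin 1 ⊕ Fin 1 → ℤ)) = ⊤) :
    u (Sum.inl 0) * w (Sum.inr 0) - u (Sum.inr 0) * w (Sum.inl 0) = 1 ∨
      u (Sum.inl 0) * w (Sum.inr 0) - u (Sum.inr 0) * w (Sum.inl 0) = -1 := by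
  have h1 : (Pi.single (Sum.inl 0) 1 : Fin 1 ⊕ Fin 1 → ℤ) ∈
      Submodule.span ℤ ({u, w} : Set (Fin 1 ⊕ Fin 1 → ℤ)) := by rw [h]; trivial
  have h2 : (Pi.single (Sum.inr 0) 1 : Fin 1 ⊕ Fin 1 → ℤ) ∈
      Submodule.span ℤ ({u, w} : Set (Fin 1 ⊕ Fin 1 → ℤ)) := by rw [h]; trivial
  obtain ⟨a, b, hab⟩ := Submodule.mem_span_pair.mp h1
  obtain ⟨c, d, hcd⟩ := Submodule.mem_span_pair.mp h2
  have e11 := congrFun hab (Sum.inl 0)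
  have e12 := congrFun hab (Sum.inr 0)
  have e21 := congrFun hcd (Sum.inl 0)
  have e22 := congrFun hcd (Sum.inr 0)
  simp only [Pi.add_apply, Pi.smul_apply, smul_eq_mul, Pi.single_eq_same, ne_eq, reduceCtorEq,
    not_false_eq_true, Pi.single_eq_of_ne] at e11 e12 e21 e22
  have hdet : (u (Sum.inl 0) * w (Sum.inr 0) - u (Sum.inr 0) * w (Sum.inl 0)) * (a * d - b * c) = 1 := by
    linear_combination (c * u (Sum.inr 0) + d * w (Sum.inr 0)) * e11 + e22 -
      (c * u (Sum.inl 0) + d * w (Sum.inl 0)) * e12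
  exact Int.eq_one_or_neg_one_of_mul_eq_one hdet

/-- The standard symplectic pairing in genus `1`: `stdSymp ℤ 1 u w = u₀ w₁ − u₁ w₀`. [folklore] -/
theorem stdSymp_one_apply (u w : Fin 1 ⊕ Fin 1 → ℤ) :
    stdSymp ℤ 1 u w = u (Sum.inl 0) * w (Sum.inr 0) - u (Sum.inr 0) * w (Sum.inl 0) := by
  rw [stdSymp_int_apply, Fin.sum_univ_one]

/-! ### The registered stub -/

/-- **Stub D-det — A HOMOTOPY SPHERE IN NORMAL FORM HAS `|u × w| = 1`.**  For `M ≃ₕ S⁴` with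
`ModelsOnFibred M 1 [(u,η),(u,¬η),(w,η′),(w,¬η′)]`: `0 = H₁(M;ℤ) ⊇ H₁(X;ℤ)`
(`H₂(M, X; ℤ) ≅ H₂(Base 1, ∂; ℤ) ≅ H²(Base 1; ℤ) = 0` by excision, integral Lefschetz duality and
universal coefficients over the concrete base `Base 1 ≃ F_{1,1} × D²`), and
`H₁(X;ℤ) ≅ ℤ²/(ℤu + ℤw)` (Gompf–Stipsicz §8.2 = PROVED tree fact
`stub_isLefschetzHandlebody_homology_H1`), so `ℤu + ℤw = ℤ²`, i.e. `u × w = ±1` for the standard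
symplectic form `stdSymp ℤ 1`. [cite: GompfStipsicz1999, §8.2] -/
theorem stub_genusOneDet :
    ∀ (M : Type) [TopologicalSpace M] [T2Space M] [SecondCountableTopology M]
      [ChartedSpace (𝔼 4) M] [IsManifold (𝓡 4) ∞ M],
      M ≃ₕ 𝕊⁴ → ∀ (u w : Fin 1 ⊕ Fin 1 → ℤ) (η η' : Bool),
      ModelsOnFibred M 1 [(u, η), (u, !η), (w, η'), (w, !η')] →
      (stdSymp ℤ 1 u w = 1 ∨ stdSymp ℤ 1 u w = -1) := by
  intro M _ _ _ _ _ e u w η η' hM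
  obtain ⟨X, _, _, _, _, _, _, bX, Ψ, hX, hglue⟩ := hM.modelsOn
  -- `ℤ u + ℤ w = ℤ²`
  have hspan : Submodule.span ℤ (letters [(u, η), (u, !η), (w, η'), (w, !η')]) = ⊤ :=
    span_letters_eq_top_of_gluing_base e bX Ψ hglue hX
  have hpair : Submodule.span ℤ ({u, w} : Set (Fin 1 ⊕ Fin 1 → ℤ)) = ⊤ :=
    top_le_iff.mp (hspan ▸ Submodule.span_mono (letters_normalForm_subset u w η η'))
  -- the determinant
  rw [stdSymp_one_apply]
  exact det_eq_one_or_neg_one_of_span_pair_eq_top u w hpair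

end Summit.SmoothPoincare4.SmoothPoincare4.Theorems.AcyclicBisectionRigidity.FoldedCurveBranchLocus

end
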